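import Literature.Analysis.FluidPDE.GKPRigidityProofs
import Literature.Analysis.FluidPDE.HarmonicLiouvilleLp
import Literature.Analysis.FluidPDE.BoundedAnnihilator
import HarnessLib

/-!
# Liouville property of uniformly locally square integrable slices of homogeneous Besov class

Analysis/FluidPDE proofs-only file (theorems only: no definition, no named fact; nothing accepted
is restated or changed). The last line of the blow-up/backward-uniqueness scheme of
Escauriaza–Seregin–Šverák reads, in its `L_{3,∞}` original (Russ. Math. Surveys 58 (2003), §3,
after (3.32)), "the velocity slice is harmonic and in `L³(ℝ³)`, hence zero". In the Besov version
of the scheme (W. Wang, Z. Zhang, *Blow-up of critical norms for the 3-D Navier–Stokes equations*,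
Sci. China Math. 60 (2017) = arXiv:1510.02589, §4 Step 3: "Hence `v ≡ 0` in `ℝ³ × (-T, 0)`. This
implies `v₃ = 0` in `ℝ³ × (-T, 0)`, since `v₃(·, t) ∈ Ḃ^{-1+3/p}_{p,q}(ℝ³)`"; equally GKP 2016,
§2.5 Step E) the slices of the blow-up limit are only uniformly locally square integrable (the
scale-invariant energy bound `A ≤ K` at every centre) and represented by tempered distributions of
homogeneous Besov class `Ḃ^{s}_{p,q}`, `s < 0` (realised: `Ṡ_j → 0`). This file proves the
corresponding Liouville property, in the exact shape `hL` consumed by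
`ancient_ae_slice_zero_of_farField_of_top_of_liouville` (`AncientLimitVanishing.lean`):

* `abs_apply_le_of_harmonicOnNhd_of_ae_eq_of_lintegral_closedBall_le` — an entire harmonic field
  agreeing a.e. with a field `f` with `∫_{B̄(x,2)} |f|² ≤ K` for all `x` is bounded (mean value
  bound `abs_le_inv_mul_setIntegral_of_harmonic` and Cauchy–Schwarz on the ball);
* `eq_zero_of_harmonicOnNhd_of_ae_eq_of_memHomBesov` — **the Liouville property**: if moreover `f`
  is represented (`IsDistributionOf`) by `W ∈ Ḃ^s_{p,q}` (`FunctionSpaces.MemHomBesov`, any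
  `s, p, q`), the harmonic field vanishes identically: bounded entire harmonic functions are
  constant (`InnerProductSpace.HarmonicOnNhd.apply_eq_apply_of_abs_le`), and realised homogeneous
  Besov distributions contain no non-zero constants
  (`eq_zero_of_isDistributionOf_const_of_memHomBesov`, BCD Def. 1.26);
* `ae_liouville_of_ae_uloc_of_ae_memHomBesov` — the packaging along a family of slices
  `t ↦ w t`, a.e. in `t`.

## References

* W. Wang, Z. Zhang, Sci. China Math. 60 (2017) 637–650 = arXiv:1510.02589, §4 Step 3.
  [WangZhang2016]
* I. Gallagher, G. S. Koch, F. Planchon, Comm. Math. Phys. 343 (2016) = arXiv:1407.4156, §2.5,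
  Step E. [GKP2016]
* H. Bahouri, J.-Y. Chemin, R. Danchin, *Fourier Analysis and Nonlinear PDE* (2011), Def. 1.26
  (the space `𝓢'_h`). [BahouriCheminDanchin2011]
* D. Gilbarg, N. S. Trudinger, *Elliptic PDE of Second Order* (2001), Thm. 2.1 (mean value) and
  Liouville's theorem. [GilbargTrudinger2001]
-/

noncomputable section

open MeasureTheory Set Function Filter Metric InnerProductSpace
open _root_.Topology
open scoped ENNReal NNReal SchwartzMap Laplacian

namespace Literature.Analysis.FluidPDE

/-! ### Boundedness from the mean value property -/

section Bounded

/-- **Harmonic fields that are uniformly locally square integrable are bounded.** If `V` is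
harmonic on `ℝ³`, `V = f` a.e., and `∫_{B̄(x, 2)} ‖f‖² ≤ K` for every `x`, then every coordinate
satisfies `|V(x)ᵢ| ≤ m⁻¹ (|B̄(0,2)| K)^{1/2}`, `m` the mass constant of the mean value bound
`abs_le_inv_mul_setIntegral_of_harmonic` (radius `R = 1`): `|Vᵢ(x)| ≤ m⁻¹ ∫_{B̄(x,2)} |Vᵢ| =
m⁻¹ ∫_{B̄(x,2)} |fᵢ| ≤ m⁻¹ ∫_{B̄(x,2)} ‖f‖ ≤ m⁻¹ |B̄(x,2)|^{1/2} (∫_{B̄(x,2)} ‖f‖²)^{1/2}`.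
[cite: GilbargTrudinger2001, Thm. 2.1] -/
theorem abs_apply_le_of_harmonicOnNhd_of_ae_eq_of_lintegral_closedBall_le
    {V f : EuclideanSpace ℝ (Fin 3) → EuclideanSpace ℝ (Fin 3)}
    (hV : HarmonicOnNhd V (univ : Set (EuclideanSpace ℝ (Fin 3)))) (hVf : V =ᵐ[volume] f)
    {K : ℝ≥0} (hK : ∀ x : EuclideanSpace ℝ (Fin 3),
      ∫⁻ y in closedBall x 2, ‖f y‖ₑ ^ 2 ≤ K) (x : EuclideanSpace ℝ (Fin 3)) (i : Fin 3) :
    |V x i| ≤ (baseBumpMass (EuclideanSpace ℝ (Fin 3)))⁻¹ *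
      ((volume (closedBall (0 : EuclideanSpace ℝ (Fin 3)) 2)) ^ (1 / 2 : ℝ) *
        (K : ℝ≥0∞) ^ (1 / 2 : ℝ)).toReal := by
  -- the harmonic coordinate
  have hcd : ContDiff ℝ 2 V := contDiffOn_univ.1 hV.contDiffOn
  have hΔ : ∀ y, Δ V y = 0 := fun y => by
    have h := (hV y (mem_univ y)).2.eq_of_nhds
    simpa using h
  set η : EuclideanSpace ℝ (Fin 3) → ℝ := fun z => V z i with hη
  have hηeq : η = (EuclideanSpace.proj i : EuclideanSpace ℝ (Fin 3) →L[ℝ] ℝ) ∘ V := by funext z; rfl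
  have hη2 : ContDiff ℝ 2 η := by
    rw [hηeq]; exact (EuclideanSpace.proj i : EuclideanSpace ℝ (Fin 3) →L[ℝ] ℝ).contDiff.comp hcd
  have hηΔ : ∀ z, (Δ η) z = 0 := fun z => by
    rw [hηeq, hcd.contDiffAt.laplacian_CLM_comp_left, Function.comp_apply, hΔ z, map_zero]
  have hharm : HarmonicOnNhd η univ := harmonicOnNhd_of_laplacian_eq_zero hη2 hηΔ
  -- mean value bound at radius `1`
  have hmv := abs_le_inv_mul_setIntegral_of_harmonic hharm one_pos x
  rw [one_pow, mul_one, show (2 * 1 : ℝ) = 2 by norm_num] at hmv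
  refine hmv.trans (mul_le_mul_of_nonneg_left ?_ (inv_nonneg.2 baseBumpMass_pos.le))
  -- `∫_{B̄(x,2)} |ηᵢ| ≤ ∫_{B̄(x,2)} ‖f‖ ≤ |B̄|^{1/2} K^{1/2}`
  set B : Set (EuclideanSpace ℝ (Fin 3)) := closedBall x 2 with hB
  have hBfin : volume B < ⊤ := (isCompact_closedBall x 2).measure_lt_top
  have hVc : Continuous V := hcd.continuous
  have hfm : AEStronglyMeasurable f volume := hVc.aestronglyMeasurable.congr hVf
  have hfmB : AEStronglyMeasurable f (volume.restrict B) := hfm.restrict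
  -- `f ∈ L²(B)`, hence `L¹(B)`
  have hK2 : ∫⁻ y in B, ‖f y‖ₑ ^ (2 : ℝ) ≤ K := by
    refine le_trans (le_of_eq (lintegral_congr fun y => ?_)) (hK x)
    rw [show (2 : ℝ) = ((2 : ℕ) : ℝ) by norm_num, ENNReal.rpow_natCast]
  have hf2 : MemLp f 2 (volume.restrict B) := by
    refine ⟨hfmB, ?_⟩
    rw [eLpNorm_eq_lintegral_rpow_enorm_toReal (by norm_num) (by norm_num)]
    simp only [ENNReal.toReal_ofNat, one_div]
    exact ENNReal.rpow_lt_top_of_nonneg (by norm_num) (lt_of_le_of_lt hK2 ENNReal.coe_lt_top).ne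
  haveI : IsFiniteMeasure (volume.restrict B) := ⟨by rw [Measure.restrict_apply_univ]; exact hBfin⟩
  have hf1 : Integrable f (volume.restrict B) := hf2.integrable (by norm_num)
  -- `∫_B |η| = ∫_B |f · i| ≤ ∫_B ‖f‖`
  have h1 : ∫ w in B, |η w| = ∫ w in B, |f w i| := by
    refine integral_congr_ae ?_
    filter_upwards [ae_restrict_of_ae (s := B) hVf] with w hw
    simp only [hη, hw]
  have h2 : ∫ w in B, |f w i| ≤ ∫ w in B, ‖f w‖ := by
    refine integral_mono_of_nonneg (Eventually.of_forall fun w => abs_nonneg _) hf1.norm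
      (Eventually.of_forall fun w => ?_)
    simpa [Real.norm_eq_abs] using PiLp.norm_apply_le (f w) i
  -- Cauchy–Schwarz in the `lintegral` form
  have h3 : ∫ w in B, ‖f w‖ = (∫⁻ w in B, ‖f w‖ₑ).toReal :=
    integral_norm_eq_lintegral_enorm hfmB
  have h4 : ∫⁻ w in B, ‖f w‖ₑ ≤ (volume B) ^ (1 / 2 : ℝ) * (K : ℝ≥0∞) ^ (1 / 2 : ℝ) := by
    have hpq : Real.HolderConjugate 2 2 := by
      rw [Real.holderConjugate_iff]; norm_num
    have h := ENNReal.lintegral_mul_le_Lp_mul_Lq (volume.restrict B) hpq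
      (f := fun _ => (1 : ℝ≥0∞)) (g := fun w => ‖f w‖ₑ) aemeasurable_const hfmB.enorm
    simp only [Pi.mul_apply, one_mul, ENNReal.one_rpow, lintegral_const, Measure.restrict_apply_univ,
      one_div] at h
    rw [one_div]
    exact h.trans (mul_le_mul' le_rfl (ENNReal.rpow_le_rpow hK2 (by norm_num)))
  have hvol : volume B = volume (closedBall (0 : EuclideanSpace ℝ (Fin 3)) 2) := by
    rw [hB, Measure.addHaar_closedBall_center]
  have hfinR : (volume (closedBall (0 : EuclideanSpace ℝ (Fin 3)) 2)) ^ (1 / 2 : ℝ) *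
      (K : ℝ≥0∞) ^ (1 / 2 : ℝ) ≠ ⊤ := by
    refine ENNReal.mul_ne_top ?_ ?_
    · exact ENNReal.rpow_ne_top_of_nonneg (by norm_num)
        (isCompact_closedBall (0 : EuclideanSpace ℝ (Fin 3)) 2).measure_lt_top.ne
    · exact ENNReal.rpow_ne_top_of_nonneg (by norm_num) ENNReal.coe_ne_top
  rw [h1]
  refine h2.trans ?_
  rw [h3, ← hvol]
  exact ENNReal.toReal_mono (hvol ▸ hfinR) h4

end Bounded

/-! ### The Liouville property -/

section Liouville

/-- **Liouville property of `L²_{uloc} ∩ Ḃ^s_{p,q}` slices** (the last step of Wang–Zhang 2017,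
§4 Step 3 / GKP 2016, §2.5 Step E, made explicit): an entire harmonic field `V` which agrees a.e.
with a field `f` satisfying `∫_{B̄(x,2)} ‖f‖² ≤ K` for all `x` and represented by a tempered
distribution `W` of homogeneous Besov class `Ḃ^s_{p,q}` (realised, `Ṡ_j W → 0` as `j → -∞`)
vanishes identically. Proof: `V` is bounded
(`abs_apply_le_of_harmonicOnNhd_of_ae_eq_of_lintegral_closedBall_le`), hence constant coordinate by
coordinate (`InnerProductSpace.HarmonicOnNhd.apply_eq_apply_of_abs_le`); `W` is then the
distribution of a constant field (`IsDistributionOf.congr_ae`), and realised Besov distributions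
contain no non-zero constants (`eq_zero_of_isDistributionOf_const_of_memHomBesov`).
[cite: WangZhang2016, §4 Step 3] [cite: GKP2016, §2.5] [cite: BahouriCheminDanchin2011, Def. 1.26] -/
theorem eq_zero_of_harmonicOnNhd_of_ae_eq_of_memHomBesov
    {V f : EuclideanSpace ℝ (Fin 3) → EuclideanSpace ℝ (Fin 3)}
    (hV : HarmonicOnNhd V (univ : Set (EuclideanSpace ℝ (Fin 3)))) (hVf : V =ᵐ[volume] f)
    {K : ℝ≥0} (hK : ∀ x : EuclideanSpace ℝ (Fin 3),
      ∫⁻ y in closedBall x 2, ‖f y‖ₑ ^ 2 ≤ K)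
    {W : 𝓢'(EuclideanSpace ℝ (Fin 3), EuclideanSpace ℂ (Fin 3))} (hW : IsDistributionOf f W)
    {s : ℝ} {p q : ℝ≥0∞} [Fact (1 ≤ p)] (hB : FunctionSpaces.MemHomBesov s p q W) :
    V = 0 := by
  -- every coordinate is a bounded entire harmonic function, hence constant
  have hcd : ContDiff ℝ 2 V := contDiffOn_univ.1 hV.contDiffOn
  have hΔ : ∀ y, Δ V y = 0 := fun y => by
    have h := (hV y (mem_univ y)).2.eq_of_nhds
    simpa using h
  have hconst : V = fun _ => V 0 := by
    funext x
    ext i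
    set η : EuclideanSpace ℝ (Fin 3) → ℝ := fun z => V z i with hη
    have hηeq : η = (EuclideanSpace.proj i : EuclideanSpace ℝ (Fin 3) →L[ℝ] ℝ) ∘ V := by
      funext z; rfl
    have hη2 : ContDiff ℝ 2 η := by
      rw [hηeq]; exact (EuclideanSpace.proj i : EuclideanSpace ℝ (Fin 3) →L[ℝ] ℝ).contDiff.comp hcd
    have hηΔ : ∀ z, (Δ η) z = 0 := fun z => by
      rw [hηeq, hcd.contDiffAt.laplacian_CLM_comp_left, Function.comp_apply, hΔ z, map_zero]
    have hharm : HarmonicOnNhd η univ := harmonicOnNhd_of_laplacian_eq_zero hη2 hηΔ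
    have hbdd : ∀ z, |η z| ≤ (baseBumpMass (EuclideanSpace ℝ (Fin 3)))⁻¹ *
        ((volume (closedBall (0 : EuclideanSpace ℝ (Fin 3)) 2)) ^ (1 / 2 : ℝ) *
          (K : ℝ≥0∞) ^ (1 / 2 : ℝ)).toReal := fun z =>
      abs_apply_le_of_harmonicOnNhd_of_ae_eq_of_lintegral_closedBall_le hV hVf hK z i
    exact hharm.apply_eq_apply_of_abs_le hbdd x 0
  -- the distribution of the constant field is realised, so the constant vanishes
  have hWV : IsDistributionOf V W := hW.congr_ae hVf.symm
  rw [hconst] at hWV ⊢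
  have h0 : V 0 = 0 := eq_zero_of_isDistributionOf_const_of_memHomBesov hWV hB
  rw [h0]
  rfl

/-- **The Liouville property along a family of slices, a.e. in time** — the hypothesis `hL` of
`ancient_ae_slice_zero_of_farField_of_top_of_liouville` (`AncientLimitVanishing.lean`) for a field
`w` whose slices are, for a.e. `t ∈ ]-1, 0[`, uniformly locally square integrable and represented
by realised distributions of class `Ḃ^s_{p,q}` (as the slices of the blow-up limit of a solution
bounded in `Ḃ^{-1+3/p}_{p,q}` are: Wang–Zhang 2017, §4 Step 1, "the lower semi-continuity of the
norm gives `‖v(t)‖_{Ḃ} ≤ M`"). [cite: WangZhang2016, §4 Steps 1 and 3] -/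
theorem ae_liouville_of_ae_uloc_of_ae_memHomBesov
    {w : ℝ → EuclideanSpace ℝ (Fin 3) → EuclideanSpace ℝ (Fin 3)} {I : Set ℝ}
    {s : ℝ} {p q : ℝ≥0∞} [Fact (1 ≤ p)]
    (h : ∀ᵐ t ∂(volume.restrict I),
      (∃ K : ℝ≥0, ∀ x : EuclideanSpace ℝ (Fin 3), ∫⁻ y in closedBall x 2, ‖w t y‖ₑ ^ 2 ≤ K) ∧
      ∃ W : 𝓢'(EuclideanSpace ℝ (Fin 3), EuclideanSpace ℂ (Fin 3)),
        IsDistributionOf (w t) W ∧ FunctionSpaces.MemHomBesov s p q W) :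
    ∀ᵐ t ∂(volume.restrict I),
      ∀ V : EuclideanSpace ℝ (Fin 3) → EuclideanSpace ℝ (Fin 3),
        HarmonicOnNhd V (univ : Set (EuclideanSpace ℝ (Fin 3))) → V =ᵐ[volume] w t → V = 0 := by
  filter_upwards [h] with t ht V hV hVw
  obtain ⟨⟨K, hK⟩, W, hW, hB⟩ := ht
  exact eq_zero_of_harmonicOnNhd_of_ae_eq_of_memHomBesov hV hVw hK hW hB

end Liouville

end Literature.Analysis.FluidPDE

end
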